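import Summits.QuantumFields.YangMills.Theses.IsotropyFromPowerCounting
import Literature.MathematicalPhysics.QuantumFieldTheory.OSReconstructionNoE1

/-!
# Crux-ideate sketch — `CurvatureSandwichBound` (stmt-QuantumFields-18372), ideator 3, round 1

First lemmas for the two idea cards (statements must ELABORATE; proofs optional):

* §A  card `hankel-rate-transfer` — the sandwich bound Σ is a GROWTH RATE: PSD-Hankel log-convexity
  of the Gram sequence of chain vectors + multiple reflections (Glimm–Jaffe Thm 10.5.5) reduce Σ
  (both frames, all spectators `W`) to VACUUM growth rates of doubled periodic chains of curvature
  insertions — Schwinger-function values of `S₁` only, computable on the axis lattice via the tie.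
* §B  card `renormalisation-blind-ratio` — the hypothesis class of Σ is closed under dilations
  `(a, c) ↦ (a/λ, λ⁴ c)`; dividing by the vacuum row leaves a dimensionless, scheme-reparametrisation
  invariant ratio statement RΣ_ε; Σ = (soft kernel K) + RΣ_ε.
-/

noncomputable section

open scoped BigOperators SchwartzMap ComplexConjugate InnerProductSpace
open MeasureTheory Filter Topology Complex
open Literature.MathematicalPhysics.QuantumLattice Literature.MathematicalPhysics.AQFT
  Literature.MathematicalPhysics.QuantumFieldTheory Literature.Probability.LatticeModels
open Summit.QuantumFields.YangMills.Theorems.NPointIsotropy.Negative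
open Summit.QuantumFields.YangMills.Theorems.CurvatureBoostCovariance.Negative

namespace Summit.QuantumFields.YangMills.Cruxes.CurvatureSandwichBound.Ideator3

/-! ## §A  Hankel–Hölder rate form -/

section Hankel

variable {𝓗 : Type*} [NormedAddCommGroup 𝓗] [InnerProductSpace ℂ 𝓗]

/-- **(A1) PSD-Hankel log-convexity.**  If the Gram matrix of a sequence of vectors is Hankel
(`⟪vᵢ, vⱼ⟫` depends on `i + j` only — the chain vectors `χⱼ = Ψ(a ⊗ τₚa ⊗ ⋯ ⊗ τ₍ⱼ₋₁₎ₚ a ⊗ τW)` of a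
reflection-symmetric insertion `a` at period `p = w + 2ℓ` have this property by translation
invariance), then `eₙ = ‖vₙ‖²` is log-convex (`eₙ² = ⟪vₙ₋₁, vₙ₊₁⟫² ≤ eₙ₋₁ eₙ₊₁`), hence
`‖v₁‖^{2m} ≤ ‖v₀‖^{2(m-1)} ‖v_m‖²`: Glimm–Jaffe (10.5.12) written for Gram entries. -/
theorem hankel_logConvex (v : ℕ → 𝓗)
    (hH : ∀ i j k l : ℕ, i + j = k + l → ⟪v i, v j⟫_ℂ = ⟪v k, v l⟫_ℂ) (m : ℕ) (hm : 1 ≤ m) :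
    ‖v 1‖ ^ (2 * m) ≤ ‖v 0‖ ^ (2 * (m - 1)) * ‖v m‖ ^ 2 := by
  set a : ℕ → ℝ := fun n => ‖v n‖ with ha
  have ha0 : ∀ n, 0 ≤ a n := fun n => norm_nonneg _
  -- log-convexity of `n ↦ ‖v n‖` from the Hankel property and Cauchy–Schwarz
  have hlc : ∀ n, a (n + 1) ^ 2 ≤ a n * a (n + 2) := by
    intro n
    have h1 : RCLike.re (⟪v (n + 1), v (n + 1)⟫_ℂ) = ‖v (n + 1)‖ * ‖v (n + 1)‖ :=
      inner_self_eq_norm_mul_norm (𝕜 := ℂ) _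
    have h2 : ⟪v (n + 1), v (n + 1)⟫_ℂ = ⟪v n, v (n + 2)⟫_ℂ := hH _ _ _ _ (by omega)
    calc a (n + 1) ^ 2 = ‖v (n + 1)‖ * ‖v (n + 1)‖ := by rw [ha]; ring
      _ = RCLike.re (⟪v n, v (n + 2)⟫_ℂ) := by rw [← h1, h2]
      _ ≤ ‖⟪v n, v (n + 2)⟫_ℂ‖ := RCLike.re_le_norm _
      _ ≤ ‖v n‖ * ‖v (n + 2)‖ := norm_inner_le_norm _ _
      _ = a n * a (n + 2) := rfl
  -- ratios increase: `a 1 * a m ≤ a 0 * a (m+1)`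
  have hQ : ∀ m, a 1 * a m ≤ a 0 * a (m + 1) := by
    intro m
    induction m with
    | zero => simp [mul_comm]
    | succ m ih =>
      rcases (ha0 (m + 1)).lt_or_eq with hpos | hzero
      · have hmpos : 0 < a m := by
          rcases (ha0 m).lt_or_eq with h | h
          · exact h
          · have := hlc m
            rw [← h, zero_mul] at this
            nlinarith
        have key : a 1 * a (m + 1) * a m ≤ a 0 * a (m + 2) * a m := by
          calc a 1 * a (m + 1) * a m = (a 1 * a m) * a (m + 1) := by ring
            _ ≤ (a 0 * a (m + 1)) * a (m + 1) := mul_le_mul_of_nonneg_right ih (ha0 _)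
            _ = a 0 * a (m + 1) ^ 2 := by ring
            _ ≤ a 0 * (a m * a (m + 2)) := mul_le_mul_of_nonneg_left (hlc m) (ha0 0)
            _ = a 0 * a (m + 2) * a m := by ring
        have := le_of_mul_le_mul_right key hmpos
        simpa [add_assoc] using this
      · have hz : a (m + 1) = 0 := hzero.symm
        calc a 1 * a (m + 1) = 0 := by rw [hz, mul_zero]
          _ ≤ a 0 * a (m + 1 + 1) := mul_nonneg (ha0 _) (ha0 _)
  -- chord inequality: `a 1 ^ m ≤ a 0 ^ (m-1) * a m`
  have hP : ∀ m, 1 ≤ m → a 1 ^ m ≤ a 0 ^ (m - 1) * a m := by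
    intro m hm
    induction m, hm using Nat.le_induction with
    | base => simp
    | succ m hm ih =>
      calc a 1 ^ (m + 1) = a 1 ^ m * a 1 := pow_succ _ _
        _ ≤ (a 0 ^ (m - 1) * a m) * a 1 := mul_le_mul_of_nonneg_right ih (ha0 1)
        _ = a 0 ^ (m - 1) * (a 1 * a m) := by ring
        _ ≤ a 0 ^ (m - 1) * (a 0 * a (m + 1)) := mul_le_mul_of_nonneg_left (hQ m) (pow_nonneg (ha0 0) _)
        _ = a 0 ^ (m - 1 + 1) * a (m + 1) := by ring
        _ = a 0 ^ (m + 1 - 1) * a (m + 1) := by rw [Nat.sub_add_cancel hm]; rfl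
  have hfin := hP m hm
  have hsq : (a 1 ^ m) ^ 2 ≤ (a 0 ^ (m - 1) * a m) ^ 2 :=
    pow_le_pow_left₀ (pow_nonneg (ha0 1) _) hfin 2
  calc ‖v 1‖ ^ (2 * m) = (a 1 ^ m) ^ 2 := by rw [ha, ← pow_mul, mul_comm]
    _ ≤ (a 0 ^ (m - 1) * a m) ^ 2 := hsq
    _ = ‖v 0‖ ^ (2 * (m - 1)) * ‖v m‖ ^ 2 := by rw [mul_pow, ← pow_mul, ha, mul_comm (m - 1)]

/-- **(A2) rate ⇒ norm.**  Under the Hankel hypothesis, an exponential RATE bound on the far end of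
the sequence (`‖v_m‖² ≤ C₀ R'^{2m}` for every `R' > R`, the constant `C₀` — which carries the whole
spectator dependence — being arbitrary) bounds the FIRST step: `‖v₁‖ ≤ R ‖v₀‖`.  This is how the
spectator `W` disappears from Σ without being estimated. -/
theorem norm_le_of_rate (v : ℕ → 𝓗)
    (hH : ∀ i j k l : ℕ, i + j = k + l → ⟪v i, v j⟫_ℂ = ⟪v k, v l⟫_ℂ) {R : ℝ} (hR : 0 ≤ R)
    (hrate : ∀ R' : ℝ, R < R' → ∃ C₀ : ℝ, ∀ m : ℕ, ‖v m‖ ^ 2 ≤ C₀ * R' ^ (2 * m)) :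
    ‖v 1‖ ≤ R * ‖v 0‖ := by
  sorry

end Hankel

/-! ### The chain-rate statement `Σ_rate` (the transfer target C⁺ of card A) -/

/-- `χ` is the periodic chain of the one-point insertion `a` at time period `p`:
`χ 0 = 1`, `χ (1+N) = a ⊗ τ_{p e₀}(χ N)` (so `χ N = a ⊗ τₚa ⊗ ⋯ ⊗ τ₍N₋₁₎ₚ a`). -/
def IsChainOf (a : 𝓢((Fin 1 → E4), ℂ)) (p : ℝ) (χ : (N : ℕ) → 𝓢((Fin N → E4), ℂ)) : Prop :=
  (∀ x, χ 0 x = 1) ∧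
    ∀ N : ℕ, IsAppendTensorOf (χ (1 + N)) a (translateMulti (p • EuclideanSpace.single 0 1) (χ N))

/-- **Chain-rate bound with spectator** for a one-species family `S`: for EVERY time-ordered
spectator `W` (offset `r + N p`, `r ≥ p`) the doubled configuration `𝔖(Θ(χ_N ⊗ τW)* ⊗ (χ_N ⊗ τW))`
grows in `N` at exponential rate at most `R²` — the constant `C₀` may depend on `W` (and on `R' > R`)
in ANY way.  Schwinger-function values only; by (A1)/(A2) this is EQUIVALENT to the operator
sandwich bound with rate `R`, and the spectator has dropped out of the estimate. -/
def ChainRateBound (S : SchwingerFamily E4) (a : 𝓢((Fin 1 → E4), ℂ)) (p R : ℝ) : Prop :=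
  ∀ (n : ℕ) (W : 𝓢((Fin n → E4), ℂ)), IsTimeOrdered W → ∀ (r : ℝ), p ≤ r →
    ∀ R' : ℝ, R < R' → ∃ C₀ : ℝ, ∀ (N : ℕ) (χ : (N : ℕ) → 𝓢((Fin N → E4), ℂ))
      (X : 𝓢((Fin (N + n) → E4), ℂ)) (H : 𝓢((Fin ((N + n) + (N + n)) → E4), ℂ)),
      IsChainOf a p χ →
      IsAppendTensorOf X (χ N) (translateMulti ((r + N * p) • EuclideanSpace.single 0 1) W) →
      IsAppendTensorOf H (osAdjoint X) X →
        ‖S ((N + n) + (N + n)) H‖ ≤ C₀ * R' ^ (2 * N)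

/-- **Vacuum chain-rate bound** (spectator `W = 1`): the further split of card A, reached from
`ChainRateBound` by a chessboard / multiple-reflection estimate on the lattice tori
(Fröhlich–Israel–Lieb–Simon Thm 4.1; Glimm–Jaffe Thm 10.5.5) when `log c_k = o(a_k L_k)`. -/
def VacuumChainBound (S : SchwingerFamily E4) (a : 𝓢((Fin 1 → E4), ℂ)) (p R : ℝ) : Prop :=
  ∀ R' : ℝ, R < R' → ∃ C₀ : ℝ, ∀ (N : ℕ) (χ : (N : ℕ) → 𝓢((Fin N → E4), ℂ))
    (H : 𝓢((Fin (N + N) → E4), ℂ)), IsChainOf a p χ → IsAppendTensorOf H (osAdjoint (χ N)) (χ N) →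
      ‖S (N + N) H‖ ≤ C₀ * R' ^ (2 * N)

/-- The insertion class of Σ at scale `(ℓ, w)`: `a = g ⊗ hh`, `g` supported in the time window
`[ℓ, ℓ + w]`, `∫|g| ≤ Mg`, `∫|hh| ≤ Mh`, `|hh| ≤ Mh'`, and `a` REFLECTION-SYMMETRIC about the window
(`τ_{(2ℓ+w)e₀} Θā = a`; the case `= -a` is the case `+` for `i·a`, and every insertion of the crux is a
sum of four such with the same budgets: real/imaginary parts of `hh`, then `g ± ḡ(2ℓ+w-·)`). -/
def IsSymInsertion (a : 𝓢((Fin 1 → E4), ℂ)) (ℓ w Mg Mh Mh' : ℝ) : Prop :=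
  ∃ (g hh : ℝ × ℝ → ℂ), (∀ x : Fin 1 → E4, a x = g (x 0 0, x 0 1) * hh (x 0 2, x 0 3)) ∧
    (∀ q : ℝ × ℝ, g q ≠ 0 → ℓ ≤ q.1 ∧ q.1 ≤ ℓ + w) ∧ Integrable g ∧ (∫ q, ‖g q‖) ≤ Mg ∧
    Integrable hh ∧ (∫ q, ‖hh q‖) ≤ Mh ∧ (∀ q, ‖hh q‖ ≤ Mh') ∧
    translateMulti ((2 * ℓ + w) • EuclideanSpace.single 0 1) (osAdjoint a) = a

/-- **`Σ_rate` at one family**: some `μ < 4` and `C` bound the chain rate of every symmetric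
insertion of the class at scale `(ℓ, w)`, `0 < ℓ ≤ w ≤ 1` (mirror gap `ℓ` = the smaller of `u, v`
after the duality `‖e^{-uH}Ae^{-vH}‖ = ‖e^{-vH}A*e^{-uH}‖`; window `w = u`), period `p = w + 2ℓ`, by
`C · Mg · (Mh + Mh') · ℓ^{-μ}`. -/
def ChainRateSandwichAt (S : SchwingerFamily E4) (μ C : ℝ) : Prop :=
  ∀ (ℓ w : ℝ), 0 < ℓ → ℓ ≤ w → w ≤ 1 → ∀ (a : 𝓢((Fin 1 → E4), ℂ)) (Mg Mh Mh' : ℝ),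
    IsSymInsertion a ℓ w Mg Mh Mh' →
      ChainRateBound S a (w + 2 * ℓ) (C * Mg * (Mh + Mh') * ℓ ^ (-μ))

/-- **C⁺ of card A (`Σ_rate`)**: the crux's own hypotheses imply the chain-rate bound for the
curvature channel AND for its 45° pull-back (whose chain moments are `S₁`-moments of DIAGONAL
chains — values of `S₁` on rotated tensors, computable on the AXIS lattice through the tie; no
diagonal transfer matrix is ever needed). -/
def ChainRateSandwich : Prop :=
  ∀ (G : Type) [Group G] [TopologicalSpace G] [IsTopologicalGroup G] [CompactSpace G]
    [MeasurableSpace G] [BorelSpace G], IsCompactSimpleLieGroup G →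
    ∀ (r : LatticeRep G) (sch : SpeciesScheme (YMSpecies G)) (S₁ : SchwingerFamily E4),
      W1 r sch S₁ → EightFrameRP S₁ → PlanarCone S₁ →
      (∃ (K : E4 → ℝ) (C η : ℝ), 0 < η ∧ ContinuousOn K {x : E4 | x ≠ 0} ∧
        (∀ x : E4, x ≠ 0 → |K x| ≤ C * (1 + ‖x‖ ^ (η - 10))) ∧
        ∀ F : 𝓢((Fin 2 → E4), ℂ), IsOffDiagonal F →
          Integrable (fun x : Fin 2 → E4 => (K (x 0 - x 1) : ℂ) * F x) ∧
          S₁ 2 F = ∫ x : Fin 2 → E4, (K (x 0 - x 1) : ℂ) * F x) →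
      ∃ μ C : ℝ, μ < 4 ∧ ChainRateSandwichAt S₁ μ C ∧
        ∀ (R : E4 ≃ₗᵢ[ℝ] E4), (∀ x : E4, R x 0 = Real.cos (Real.pi / 4) * x 0 + Real.sin (Real.pi / 4) * x 1 ∧
          R x 1 = -Real.sin (Real.pi / 4) * x 0 + Real.cos (Real.pi / 4) * x 1 ∧ R x 2 = x 2 ∧ R x 3 = x 3) →
          ChainRateSandwichAt (fun n => (S₁ n).comp (linActMulti R)) μ C

/-- **(A3) THE TRANSFER `Σ_rate → Σ`** (model-blind given E2 + translations of `S₁` and of `S₁∘R`,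
both in the crux's binders `h`, `h'`): split the insertion into four symmetric ones; if `v < u` use
the duality to put the gap `v` next to the mirror; form the chain vectors
`vⱼ = Ψ(χⱼ ⊗ τ_{r + j p} W)` — their Gram matrix is Hankel by translation invariance and the symmetry
of `a` — and apply (A1)/(A2): the spectator `W` only enters `C₀`. -/
theorem curvatureSandwichBound_of_chainRates (hrate : ChainRateSandwich) :
    Summit.QuantumFields.YangMills.Theses.IsotropyFromPowerCounting.CurvatureSandwichBound := by
  sorry

/-! ## §B  Dilation closure and the renormalisation-blind ratio -/

namespace Dilate

variable {ι : Type}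

/-- **(B1) Dilation of a scheme**: `(a_k, c_k) ↦ (a_k/λ, λ⁴ c_k)`, `β, L, m` unchanged.  The class of
tied Wilson limits is closed under `S₁ ↦ S₁ ∘ D_λ` with this re-parametrisation. -/
def scheme (sch : SpeciesScheme ι) (lam : ℝ) (hlam : 0 < lam) : SpeciesScheme ι where
  a := fun k => sch.a k / lam
  a_pos := fun k => div_pos (sch.a_pos k) hlam
  tendsto_a := by simpa using sch.tendsto_a.div_const lam
  β := sch.β
  L := sch.L
  tendsto_L := by
    have h : (fun k => sch.a k / lam * (sch.L k : ℝ)) = fun k => sch.a k * sch.L k / lam := by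
      funext k; ring
    rw [h]
    exact sch.tendsto_L.atTop_div_const hlam
  c := fun s k => lam ^ 4 * sch.c s k
  m := sch.m

variable {G : Type} [MeasurableSpace G]

/-- **(B2) The smeared renormalised lattice field is dilation-covariant**: smearing the dilated
scheme's field with `f` equals smearing the original field with `f(·/λ)`. -/
theorem smearedLatticeField_dilate (O : LGConfig 4 G → ℝ) (Λ : Finset (Site 4)) (a c m lam : ℝ)
    (hlam : 0 < lam) (f fl : 𝓢(EuclideanSpace ℝ (Fin 4), ℝ))
    (hf : ∀ x, fl x = f (lam⁻¹ • x)) (U : LGConfig 4 G) :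
    smearedLatticeField O Λ (a / lam) (lam ^ 4 * c) m f U = smearedLatticeField O Λ a c m fl U := by
  have hl : lam ≠ 0 := hlam.ne'
  unfold smearedLatticeField
  have hx : ∀ x : Site 4, fl (a • siteToE x) = f ((a / lam) • siteToE x) := fun x => by
    rw [hf, smul_smul, div_eq_mul_inv, mul_comm]
  simp_rw [hx]
  have h4 : lam ^ 4 * c * (a / lam) ^ 4 = c * a ^ 4 := by
    have : a / lam * lam = a := div_mul_cancel₀ a hl
    calc lam ^ 4 * c * (a / lam) ^ 4 = c * (a / lam * lam) ^ 4 := by ring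
      _ = c * a ^ 4 := by rw [this]
  rw [h4]

end Dilate

/-- **(B3) exponent bookkeeping**: a ratio bound with sub-power loss `u^{-ε}` against an envelope
`V`, plus the vacuum-row envelope `V u ≤ C₂ u^{-μ₀}` (from the soft kernel: `μ₀ = 4 − η/2`), give
the sandwich exponent `μ₀ + ε` (which is `< 4` for `ε < η/2`). -/
theorem sandwich_of_ratio_and_row (N V : ℝ → ℝ) {C₁ C₂ ε μ₀ : ℝ} (hC₁ : 0 ≤ C₁)
    (hN : ∀ u : ℝ, 0 < u → u ≤ 1 → N u ≤ C₁ * u ^ (-ε) * V u)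
    (hV : ∀ u : ℝ, 0 < u → u ≤ 1 → V u ≤ C₂ * u ^ (-μ₀)) :
    ∀ u : ℝ, 0 < u → u ≤ 1 → N u ≤ C₁ * C₂ * u ^ (-(μ₀ + ε)) := by
  intro u hu hu1
  have h0 : 0 ≤ C₁ * u ^ (-ε) := mul_nonneg hC₁ (Real.rpow_nonneg hu.le _)
  calc N u ≤ C₁ * u ^ (-ε) * V u := hN u hu hu1
    _ ≤ C₁ * u ^ (-ε) * (C₂ * u ^ (-μ₀)) := by gcongr; exact hV u hu hu1
    _ = C₁ * C₂ * u ^ (-(μ₀ + ε)) := by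
        rw [show -(μ₀ + ε) = -ε + -μ₀ by ring, Real.rpow_add hu]; ring

/-- A **vacuum-row envelope** for the insertion class (fixed transverse budgets `Mh, Mh'`): every
insertion `f₁ = g ⊗ hh` with window `[u', 2u']` and `∫|g| ≤ Mg` has single-insertion vector norm
`‖Ψ(f₁)‖ ≤ Mg · 𝓥 u'`. -/
def IsVacuumRowEnvelope (S : SchwingerFamily E4) (h : OSReconstructionNoE1 S.toLabelled)
    (Mh Mh' : ℝ) (𝓥 : ℝ → ℝ) : Prop :=
  ∀ (u' : ℝ), 0 < u' → u' ≤ 1 → ∀ (f₁ : 𝓢((Fin 1 → E4), ℂ)) (hf₁ : IsTimeOrdered f₁)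
    (g hh : ℝ × ℝ → ℂ) (Mg : ℝ),
    (∀ x : Fin 1 → E4, f₁ x = g (x 0 0, x 0 1) * hh (x 0 2, x 0 3)) →
    (∀ q : ℝ × ℝ, g q ≠ 0 → u' ≤ q.1 ∧ q.1 ≤ 2 * u') → Integrable g → (∫ q, ‖g q‖) ≤ Mg →
    Integrable hh → (∫ q, ‖hh q‖) ≤ Mh → (∀ q, ‖hh q‖ ≤ Mh') →
      ‖h.fieldVec 1 (fun _ => ()) f₁ hf₁‖ ≤ Mg * 𝓥 u'

/-- **RΣ_ε at one family** ("the sandwich is its own vacuum row"): for every `ε > 0` a constant `C`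
such that ANY vacuum-row envelope `𝓥` of the class also envelopes the operator rows, at the price
`(min u v)^{-ε}` and a halving of the scale.  Dimensionless: invariant under `(a,c) ↦ (a/λ, λ⁴c)`
and under `c ↦ κ c` — it cannot see the scheme's renormalisation constants. -/
def RatioSandwichAt (S : SchwingerFamily E4) (h : OSReconstructionNoE1 S.toLabelled) : Prop :=
  ∀ ε : ℝ, 0 < ε → ∃ C : ℝ, ∀ (Mh Mh' : ℝ) (𝓥 : ℝ → ℝ), IsVacuumRowEnvelope S h Mh Mh' 𝓥 →
    ∀ (u v : ℝ), 0 < u → 0 < v → u ≤ 1 → v ≤ 1 →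
    ∀ (f₁ : 𝓢((Fin 1 → E4), ℂ)) (g hh : ℝ × ℝ → ℂ) (Mg : ℝ),
      (∀ x : Fin 1 → E4, f₁ x = g (x 0 0, x 0 1) * hh (x 0 2, x 0 3)) →
      (∀ q : ℝ × ℝ, g q ≠ 0 → u ≤ q.1 ∧ q.1 ≤ 2 * u) → Integrable g → (∫ q, ‖g q‖) ≤ Mg →
      Integrable hh → (∫ q, ‖hh q‖) ≤ Mh → (∀ q, ‖hh q‖ ≤ Mh') →
      ∀ (n : ℕ) (W : 𝓢((Fin n → E4), ℂ)) (hW : IsTimeOrdered W)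
        (hFW : IsTimeOrdered
          (SchwartzMap.appendTensor f₁ (translateMulti ((2 * u + v) • EuclideanSpace.single 0 1) W))),
        ‖h.fieldVec (1 + n) (fun _ => ())
            (SchwartzMap.appendTensor f₁ (translateMulti ((2 * u + v) • EuclideanSpace.single 0 1) W))
            hFW‖ ≤
          C * Mg * (min u v) ^ (-ε) * 𝓥 (min u v / 2) * ‖h.fieldVec n (fun _ => ()) W hW‖

/-- **C⁺ of card B (`RΣ`)**: the crux prefix implies `RatioSandwichAt` for `S₁` and for the 45°
pull-back. -/
def RatioSandwich : Prop :=
  ∀ (G : Type) [Group G] [TopologicalSpace G] [IsTopologicalGroup G] [CompactSpace G]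
    [MeasurableSpace G] [BorelSpace G], IsCompactSimpleLieGroup G →
    ∀ (r : LatticeRep G) (sch : SpeciesScheme (YMSpecies G)) (S₁ : SchwingerFamily E4),
      W1 r sch S₁ → EightFrameRP S₁ → PlanarCone S₁ →
      (∀ h : OSReconstructionNoE1 S₁.toLabelled, RatioSandwichAt S₁ h) ∧
        ∀ (R : E4 ≃ₗᵢ[ℝ] E4), (∀ x : E4, R x 0 = Real.cos (Real.pi / 4) * x 0 + Real.sin (Real.pi / 4) * x 1 ∧
          R x 1 = -Real.sin (Real.pi / 4) * x 0 + Real.cos (Real.pi / 4) * x 1 ∧ R x 2 = x 2 ∧ R x 3 = x 3) →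
          ∀ h' : OSReconstructionNoE1 (SchwingerFamily.toLabelled (fun n => (S₁ n).comp (linActMulti R))),
            RatioSandwichAt (fun n => (S₁ n).comp (linActMulti R)) h'

/-- **(B4) THE TRANSFER `RΣ → Σ`**: the soft kernel supplies the envelope
`𝓥(u') = C_K (Mh + Mh') (u'^{-(4 − η/2)} + 1)` (vacuum row = `∫∫ K(·, y − y') hh hh`, split at
`|y − y'| = 1`), and (B3) turns `RΣ_ε` with `ε < η/2` into Σ with `μ = 4 − η/2 + ε < 4`. -/
theorem curvatureSandwichBound_of_ratio (hR : RatioSandwich) :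
    Summit.QuantumFields.YangMills.Theses.IsotropyFromPowerCounting.CurvatureSandwichBound := by
  sorry

end Summit.QuantumFields.YangMills.Cruxes.CurvatureSandwichBound.Ideator3

end
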